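import Literature.Topology.FourManifolds.CollarCriterion
import Literature.Topology.FourManifolds.SublevelDiffeoControlled

/-!
# Helpers (pushes along an open collar) for stub `stub_coreIndependence` of line
`lp-by-sphere-system-surgery` for crux `AgkCor6Sufficiency`
(item stmt-SmoothPoincare4-10894, routes CongruenceShadows / GroupTrisection; lead reshape r5)

For open collar data `c` of a boundary datum `b` of a compact manifold with boundary `W`
(`BoundaryData.OpenCollarData`, `CollarCriterion.lean`: collar map `c x t`, `0 ≤ t < top`, with
inverse `(proj, height)` smooth on the open `region`) this file provides:

* §1 a cut-off profile `cutProfile ℓ` (`= id` on `(-∞, ℓ]`, `= 1` on `[1, ∞)`, `> ℓ` on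
  `(ℓ, ∞)`, smooth; `ℓ < 1`), after the tree's `heightProfile` (`CollarHeightFunction.lean`);
* §2 the **collar-height function** `heightFn c ℓ = cutProfile ℓ ∘ height` on `region`, `1` off
  it: smooth on `W` (constant off the compact closed collar), with sublevel sets
  `{heightFn < α} = c (∂W × [0, α))` for `α ≤ ℓ`, regular and interior on `c (∂W × (0, ℓ))` (the
  height is the identity along the collar lines; adapted from `CollarHeightFunction.lean`, which
  treats the long open collars of `OpenCollar.lean`);
* §3 the **push along the collar**: for `0 < α ≤ β < 1` a self-diffeomorphism of `W`, equal to
  the identity off a compact subset of the interior, carrying `c (∂W × [0, α))` onto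
  `c (∂W × [0, β))` — Milnor's regular interval theorem (*Morse theory* (1963), Thm. 3.1) in the
  tree's ambient form on compact manifolds with boundary
  (`exists_diffeomorph_image_sublevel_eq_of_isInteriorPoint_le`, `SublevelDiffeoControlled.lean`)
  applied to `c.heightFn`;
* §4 the registered helper stub `stub_coreIndependencePush`.

References: J. Milnor, *Morse theory* (1963), Thm. 3.1 [Milnor1963]; J. Milnor, *Lectures on the
h-cobordism theorem* (1965), §1 [MilnorHCobordism1965].
-/

noncomputable section

-- the prescribed namespace `Summit.<P>.<Sub>.…` duplicates `SmoothPoincare4` (P = Sub)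
set_option linter.dupNamespace false

open Set Function ContinuousMap
open scoped Manifold ContDiff Topology

namespace Summit.SmoothPoincare4.SmoothPoincare4.Cruxes.AgkCor6Sufficiency.LpBySphereSystemSurgery

open Literature.Topology.FourManifolds

namespace CoreIndependence

/-! ## 1. The cut-off profile -/

section Profile

variable {ℓ : ℝ}

/-- The smooth step `σ_ℓ(t) = smoothTransition ((t - ℓ)/(1 - ℓ))`: `0` on `t ≤ ℓ`, `1` on `t ≥ 1`
(for `ℓ < 1`). [folklore] -/
def cutStep (ℓ t : ℝ) : ℝ := Real.smoothTransition ((t - ℓ) / (1 - ℓ))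

/-- **The cut-off profile** `ψ_ℓ(t) = (1 - σ_ℓ t) t + σ_ℓ t`: the identity on `(-∞, ℓ]`, `1` on
`[1, ∞)`, `> ℓ` on `(ℓ, ∞)`. [folklore] -/
def cutProfile (ℓ t : ℝ) : ℝ := (1 - cutStep ℓ t) * t + cutStep ℓ t

/-- The profile is smooth. [folklore] -/
theorem contDiff_cutProfile (ℓ : ℝ) : ContDiff ℝ ∞ (cutProfile ℓ) := by
  have h : ContDiff ℝ ∞ (cutStep ℓ) :=
    Real.smoothTransition.contDiff.comp ((contDiff_id.sub contDiff_const).div_const _)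
  exact ((contDiff_const.sub h).mul contDiff_id).add h

/-- Below `ℓ` the profile is the identity. [folklore] -/
theorem cutProfile_of_le (hℓ : ℓ < 1) {t : ℝ} (ht : t ≤ ℓ) : cutProfile ℓ t = t := by
  have h : cutStep ℓ t = 0 :=
    Real.smoothTransition.zero_of_nonpos (div_nonpos_of_nonpos_of_nonneg (by linarith) (by linarith))
  simp [cutProfile, h]

/-- Above `1` the profile is `1`. [folklore] -/
theorem cutProfile_of_one_le (hℓ : ℓ < 1) {t : ℝ} (ht : 1 ≤ t) : cutProfile ℓ t = 1 := by
  have h : cutStep ℓ t = 1 :=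
    Real.smoothTransition.one_of_one_le ((one_le_div (by linarith)).2 (by linarith))
  simp [cutProfile, h]

/-- Above `ℓ` the profile stays above `ℓ`. [folklore] -/
theorem lt_cutProfile (hℓ : ℓ < 1) {t : ℝ} (ht : ℓ < t) : ℓ < cutProfile ℓ t := by
  rcases le_or_gt 1 t with h1 | h1
  · rw [cutProfile_of_one_le hℓ h1]; exact hℓ
  · have h0 : 0 ≤ cutStep ℓ t := Real.smoothTransition.nonneg _
    have : cutProfile ℓ t = t + cutStep ℓ t * (1 - t) := by unfold cutProfile; ring
    rw [this]
    nlinarith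

/-- **The sublevel sets below `ℓ`**: for `α ≤ ℓ`, `ψ_ℓ t < α ↔ t < α`. [folklore] -/
theorem cutProfile_lt_iff (hℓ : ℓ < 1) {α t : ℝ} (hα : α ≤ ℓ) : cutProfile ℓ t < α ↔ t < α := by
  rcases le_or_gt t ℓ with ht | ht
  · rw [cutProfile_of_le hℓ ht]
  · constructor
    · intro h; exact absurd ((lt_cutProfile hℓ ht).trans h) (not_lt.2 hα)
    · intro h; exact absurd (h.trans_le hα) (not_lt.2 ht.le)

/-- A value `≤ ℓ` of the profile is the argument. [folklore] -/
theorem cutProfile_eq_self_of_le (hℓ : ℓ < 1) {t : ℝ} (h : cutProfile ℓ t ≤ ℓ) :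
    cutProfile ℓ t = t := by
  rcases le_or_gt t ℓ with ht | ht
  · exact cutProfile_of_le hℓ ht
  · exact absurd (lt_cutProfile hℓ ht) (not_lt.2 h)

end Profile

/-! ## 2. Open collar data: interior points, the collar-height function, regularity -/

section CollarFacts

variable {n : ℕ} {W : Type} [TopologicalSpace W] [ChartedSpace (EuclideanHalfSpace (n + 2)) W]
  {b : BoundaryData (𝓡∂ (n + 2)) W (𝓡 (n + 1))} (c : b.OpenCollarData)

/-- On `region` the height vanishes exactly on the boundary. [folklore] -/
theorem height_eq_zero_iff {z : W} (hz : z ∈ c.region) :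
    c.height z = 0 ↔ z ∈ (𝓡∂ (n + 2)).boundary W := by
  constructor
  · intro h
    rw [← b.range_incl, ← c.apply_proj_height z hz, h, c.apply_zero]
    exact mem_range_self _
  · rw [← b.range_incl]
    rintro ⟨x, rfl⟩
    rw [← c.apply_zero, c.height_apply x 0 ⟨le_rfl, c.top_pos⟩]

/-- **A point of the collar region of positive height is an interior point** (the boundary is
`∂W × {0}`). [folklore] -/
theorem isInteriorPoint_of_height_pos {z : W} (hz : z ∈ c.region) (h : 0 < c.height z) :
    (𝓡∂ (n + 2)).IsInteriorPoint z := by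
  rw [ModelWithCorners.isInteriorPoint_iff_not_isBoundaryPoint]
  intro h'
  have h'' : z ∈ (𝓡∂ (n + 2)).boundary W := h'
  rw [← height_eq_zero_iff c hz] at h''
  exact h.ne' h''

/-- **The image of the collar below the level `α ≤ 1` is `region ∩ {height < α}`.** [folklore] -/
theorem image_collarMap_lt {α : ℝ} (hα : α ≤ 1) :
    c.collarMap '' {p | (p.2 : ℝ) < α} = c.region ∩ c.height ⁻¹' Iio α := by
  ext z
  constructor
  · rintro ⟨p, hp, rfl⟩
    exact ⟨c.collarMap_mem_region p, by simpa [c.height_collarMap] using hp⟩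
  · rintro ⟨hz, hzα⟩
    have hh := c.height_mem z hz
    exact ⟨(c.proj z, ⟨c.height z, hh.1, (le_of_lt hzα).trans hα⟩), hzα, c.apply_proj_height z hz⟩

/-- **The collar-height function**: the cut-off profile of the height on the collar region, `1`
off it. [cite: MilnorHCobordism1965, §1 after Thm. 1.4] -/
def heightFn (ℓ : ℝ) (z : W) : ℝ := by
  classical
  exact if z ∈ c.region then cutProfile ℓ (c.height z) else 1

/-- On the region the height function is the profile of the height. [folklore] -/
theorem heightFn_of_mem (ℓ : ℝ) {z : W} (hz : z ∈ c.region) :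
    heightFn c ℓ z = cutProfile ℓ (c.height z) := by
  classical
  unfold heightFn; rw [if_pos hz]

/-- Off the region the height function is `1`. [folklore] -/
theorem heightFn_of_not_mem (ℓ : ℝ) {z : W} (hz : z ∉ c.region) : heightFn c ℓ z = 1 := by
  classical
  unfold heightFn; rw [if_neg hz]

/-- **The strict sublevel sets below `ℓ` are the open collar ends**: for `α ≤ ℓ < 1`,
`heightFn z < α ↔ z ∈ region ∧ height z < α`. [folklore] -/
theorem heightFn_lt_iff {ℓ α : ℝ} (hℓ : ℓ < 1) (hα : α ≤ ℓ) (z : W) :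
    heightFn c ℓ z < α ↔ z ∈ c.region ∧ c.height z < α := by
  by_cases hz : z ∈ c.region
  · rw [heightFn_of_mem c ℓ hz, cutProfile_lt_iff hℓ hα]
    exact ⟨fun h => ⟨hz, h⟩, fun h => h.2⟩
  · rw [heightFn_of_not_mem c ℓ hz]
    constructor
    · intro h; linarith
    · exact fun h => (hz h.1).elim

/-- A point where the height function is `≤ ℓ < 1` lies in the region, and there the function is
the height. [folklore] -/
theorem mem_region_of_heightFn_le {ℓ : ℝ} (hℓ : ℓ < 1) {z : W} (h : heightFn c ℓ z ≤ ℓ) :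
    z ∈ c.region ∧ heightFn c ℓ z = c.height z := by
  by_cases hz : z ∈ c.region
  · rw [heightFn_of_mem c ℓ hz] at h ⊢
    exact ⟨hz, cutProfile_eq_self_of_le hℓ h⟩
  · rw [heightFn_of_not_mem c ℓ hz] at h
    exact absurd (h.trans_lt hℓ) (lt_irrefl _)

/-- Off the closed collar `c (∂W × [0, 1])` the height function is `1`. [folklore] -/
theorem heightFn_eq_one_of_not_mem_range {ℓ : ℝ} (hℓ : ℓ < 1) {z : W} (hz : z ∉ range c.collarMap) :
    heightFn c ℓ z = 1 := by
  by_cases hr : z ∈ c.region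
  · rw [heightFn_of_mem c ℓ hr]
    refine cutProfile_of_one_le hℓ ?_
    by_contra h1
    refine hz ⟨(c.proj z, ⟨c.height z, (c.height_mem z hr).1, le_of_lt (not_le.1 h1)⟩), ?_⟩
    exact c.apply_proj_height z hr
  · exact heightFn_of_not_mem c ℓ hr

/-- **The collar-height function is smooth** (`W` compact): `ψ_ℓ ∘ height` on the open region,
constant `1` off the compact closed collar; the two open sets cover. [folklore] -/
theorem contMDiff_heightFn [T2Space W] [CompactSpace W] [IsManifold (𝓡∂ (n + 2)) ∞ W] {ℓ : ℝ}
    (hℓ : ℓ < 1) : ContMDiff (𝓡∂ (n + 2)) 𝓘(ℝ, ℝ) ∞ (heightFn c ℓ) := by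
  haveI : CompactSpace b.carrier := b.compactSpace_carrier
  have hK : IsCompact (range c.collarMap) := isCompact_range c.continuous_collarMap
  apply contMDiff_of_locally_contMDiffOn
  intro z
  by_cases hz : z ∈ range c.collarMap
  · refine ⟨c.region, c.isOpen_region, ?_, ?_⟩
    · obtain ⟨p, rfl⟩ := hz
      exact c.collarMap_mem_region p
    · have h := (contDiff_cutProfile ℓ).contMDiff.comp_contMDiffOn c.contMDiffOn_height
      exact h.congr fun y hy => heightFn_of_mem c ℓ hy
  · refine ⟨(range c.collarMap)ᶜ, hK.isClosed.isOpen_compl, hz, ?_⟩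
    exact (contMDiffOn_const (c := (1 : ℝ))).congr fun y hy =>
      heightFn_eq_one_of_not_mem_range c hℓ hy

/-- **The height has non-zero derivative at every point of the collar region of positive
height**: along the collar line `t ↦ c x t` it is the identity. [folklore] -/
theorem mfderiv_height_ne_zero [IsManifold (𝓡∂ (n + 2)) ∞ W] {z : W} (hz : z ∈ c.region)
    (h0 : 0 < c.height z) : mfderiv (𝓡∂ (n + 2)) 𝓘(ℝ, ℝ) c.height z ≠ 0 := by
  -- adapted from `BoundaryData.OpenCollar.mfderiv_height_ne_zero` (CollarHeightFunction.lean)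
  intro hzero
  set x := c.proj z with hx
  set t₀ := c.height z with ht₀
  have htop : t₀ < c.top := (c.height_mem z hz).2
  have hzt : c.toFun x t₀ = z := c.apply_proj_height z hz
  -- the collar line through `z` is smooth at `t₀ ∈ (0, top)`
  have hγ : ContMDiffAt 𝓘(ℝ, ℝ) (𝓡∂ (n + 2)) ∞ (fun t : ℝ => c.toFun x t) t₀ := by
    have hmem : univ ×ˢ Ico (0 : ℝ) c.top ∈ 𝓝 (x, t₀) :=
      Filter.mem_of_superset ((isOpen_univ.prod isOpen_Ioo).mem_nhds ⟨mem_univ _, h0, htop⟩)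
        (prod_mono_right Ioo_subset_Ico_self)
    have h1 : ContMDiffAt ((𝓡 (n + 1)).prod 𝓘(ℝ, ℝ)) (𝓡∂ (n + 2)) ∞ (uncurry c.toFun) (x, t₀) :=
      c.contMDiffOn_toFun.contMDiffAt hmem
    exact h1.comp t₀ (contMDiffAt_const.prodMk contMDiffAt_id)
  have hγd : MDifferentiableAt 𝓘(ℝ, ℝ) (𝓡∂ (n + 2)) (fun t : ℝ => c.toFun x t) t₀ :=
    hγ.mdifferentiableAt (by simp)
  have hhd : MDifferentiableAt (𝓡∂ (n + 2)) 𝓘(ℝ, ℝ) c.height (c.toFun x t₀) := by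
    rw [hzt]
    exact (c.contMDiffOn_height.contMDiffAt (c.isOpen_region.mem_nhds hz)).mdifferentiableAt
      (by simp)
  -- `height ∘ line = id` near `t₀`
  have hev : (c.height ∘ fun t : ℝ => c.toFun x t) =ᶠ[𝓝 t₀] id := by
    filter_upwards [isOpen_Ioo.mem_nhds ⟨h0, htop⟩] with t ht
    exact c.height_apply x t ⟨le_of_lt ht.1, ht.2⟩
  have hcomp := mfderiv_comp t₀ hhd hγd
  rw [hzt] at hcomp
  rw [hzero, ContinuousLinearMap.zero_comp] at hcomp
  have hid : mfderiv 𝓘(ℝ, ℝ) 𝓘(ℝ, ℝ) (c.height ∘ fun t : ℝ => c.toFun x t) t₀ =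
      ContinuousLinearMap.id ℝ ℝ := by
    rw [hev.mfderiv_eq]
    exact mfderiv_id
  rw [hid] at hcomp
  have h1 := DFunLike.congr_fun hcomp (1 : ℝ)
  change (1 : ℝ) = 0 at h1
  exact one_ne_zero h1

/-- **The collar-height function has non-zero derivative on `c (∂W × (0, ℓ))`**: there it agrees
with the height near the point. [cite: MilnorHCobordism1965, Lemma 2.9] -/
theorem mfderiv_heightFn_ne_zero [IsManifold (𝓡∂ (n + 2)) ∞ W] {ℓ : ℝ} (hℓ : ℓ < 1) {z : W}
    (hz : z ∈ c.region) (h0 : 0 < c.height z) (h1 : c.height z < ℓ) :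
    mfderiv (𝓡∂ (n + 2)) 𝓘(ℝ, ℝ) (heightFn c ℓ) z ≠ 0 := by
  have hO : IsOpen (c.region ∩ c.height ⁻¹' Iio ℓ) :=
    c.continuousOn_height.isOpen_inter_preimage c.isOpen_region isOpen_Iio
  have hev : heightFn c ℓ =ᶠ[𝓝 z] c.height := by
    filter_upwards [hO.mem_nhds ⟨hz, h1⟩] with y hy
    rw [heightFn_of_mem c ℓ hy.1, cutProfile_of_le hℓ (le_of_lt hy.2)]
  rw [hev.mfderiv_eq]
  exact mfderiv_height_ne_zero c hz h0

end CollarFacts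

/-! ## 3. The push along the collar -/

section Push

variable {n : ℕ} {W : Type} [TopologicalSpace W] [T2Space W] [CompactSpace W]
  [ChartedSpace (EuclideanHalfSpace (n + 2)) W] [IsManifold (𝓡∂ (n + 2)) ∞ W]
  {b : BoundaryData (𝓡∂ (n + 2)) W (𝓡 (n + 1))} (c : b.OpenCollarData)

/-- **Pushing along an open collar** (Milnor, *Morse theory* (1963), Thm. 3.1, ambient form on
a compact manifold with boundary): for `0 < α ≤ β < 1` there is a self-diffeomorphism `Φ` of
`W`, equal to the identity off a compact subset of the interior `W ∖ ∂W`, carrying the open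
collar end `c (∂W × [0, α))` onto `c (∂W × [0, β))`.  It is the diffeomorphism of the tree's
`exists_diffeomorph_image_sublevel_eq_of_isInteriorPoint_le` for the collar-height function
`f = c.heightFn ℓ`, `ℓ = (β + 1)/2`: the slab `f⁻¹[α - 2δ₀, β + 2δ₀]` consists of collar points
of height in `(0, ℓ)`, which are regular (`mfderiv_heightFn_ne_zero`) and interior
(`isInteriorPoint_of_height_pos`); `Φ {f ≤ α} = {f ≤ β}` and `Φ (f⁻¹ α) = f⁻¹ β` give
`Φ {f < α} = {f < β}`, and `Φ = id` off `f⁻¹[α - 2δ, β + 2δ]`.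
[cite: Milnor1963, Thm. 3.1 and its proof] -/
theorem exists_diffeomorph_image_collar_eq {α β : ℝ} (hα : 0 < α) (hαβ : α ≤ β) (hβ : β < 1) :
    ∃ Φ : W ≃ₘ⟮𝓡∂ (n + 2), 𝓡∂ (n + 2)⟯ W,
      (∃ K : Set W, IsCompact K ∧ K ⊆ (𝓡∂ (n + 2)).interior W ∧ ∀ w, w ∉ K → Φ w = w) ∧
      Φ '' (c.collarMap '' {p | (p.2 : ℝ) < α}) = c.collarMap '' {p | (p.2 : ℝ) < β} := by
  -- the level `ℓ` up to which the collar-height function is the height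
  set ℓ : ℝ := (β + 1) / 2 with hℓdef
  have hℓ1 : ℓ < 1 := by rw [hℓdef]; linarith
  have hβℓ : β < ℓ := by rw [hℓdef]; linarith
  set f : W → ℝ := heightFn c ℓ with hfdef
  have hf : ContMDiff (𝓡∂ (n + 2)) 𝓘(ℝ, ℝ) ∞ f := contMDiff_heightFn c hℓ1
  -- width: the slab `f⁻¹[α - 2δ₀, β + 2δ₀]` stays inside `c (∂W × (0, ℓ))`
  set δ₀ : ℝ := min (α / 4) ((ℓ - β) / 4) with hδ₀def
  have hδ₀ : 0 < δ₀ := lt_min (by linarith) (by linarith)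
  have hδ₀α : 2 * δ₀ < α := by
    have h := min_le_left (α / 4) ((ℓ - β) / 4)
    rw [← hδ₀def] at h
    linarith
  have hδ₀β : β + 2 * δ₀ < ℓ := by
    have h := min_le_right (α / 4) ((ℓ - β) / 4)
    rw [← hδ₀def] at h
    linarith
  have hslab : ∀ x, f x ∈ Icc (α - 2 * δ₀) (β + 2 * δ₀) →
      x ∈ c.region ∧ 0 < c.height x ∧ c.height x < ℓ := by
    intro x hx
    obtain ⟨hxr, hfx⟩ := mem_region_of_heightFn_le c hℓ1 (hx.2.trans hδ₀β.le)
    refine ⟨hxr, ?_, ?_⟩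
    · rw [← hfx]; linarith [hx.1]
    · rw [← hfx]; linarith [hx.2]
  have hreg : ∀ x, f x ∈ Icc α β → mfderiv (𝓡∂ (n + 2)) 𝓘(ℝ, ℝ) f x ≠ 0 := by
    intro x hx
    obtain ⟨hxr, h0, hl⟩ := hslab x ⟨by linarith [hx.1], by linarith [hx.2]⟩
    exact mfderiv_heightFn_ne_zero c hℓ1 hxr h0 hl
  have hint : ∀ x, f x ∈ Icc α β → (𝓡∂ (n + 2)).IsInteriorPoint x := by
    intro x hx
    obtain ⟨hxr, h0, -⟩ := hslab x ⟨by linarith [hx.1], by linarith [hx.2]⟩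
    exact isInteriorPoint_of_height_pos c hxr h0
  obtain ⟨δ, Φ, hδ, hδle, himage, hlevel, hid, -, -, -⟩ :=
    exists_diffeomorph_image_sublevel_eq_of_isInteriorPoint_le hf hαβ hreg hint hδ₀
  -- the open collar ends as strict sublevel sets of `f`
  have hset : ∀ γ, γ ≤ β → c.collarMap '' {p | (p.2 : ℝ) < γ} = {x | f x ≤ γ} \ f ⁻¹' {γ} := by
    intro γ hγ
    ext x
    have key : f x < γ ↔ x ∈ c.region ∧ c.height x < γ := heightFn_lt_iff c hℓ1 (hγ.trans hβℓ.le) x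
    rw [image_collarMap_lt c (hγ.trans hβ.le)]
    simp only [mem_inter_iff, mem_preimage, mem_Iio, mem_sdiff, mem_setOf_eq, mem_singleton_iff]
    rw [← key]
    exact lt_iff_le_and_ne
  refine ⟨Φ, ⟨f ⁻¹' Icc (α - 2 * δ) (β + 2 * δ), (isClosed_Icc.preimage hf.continuous).isCompact,
    fun x hx => ?_, fun w hw => hid w ?_⟩, ?_⟩
  · obtain ⟨hxr, h0, -⟩ := hslab x ⟨by linarith [hx.1], by linarith [hx.2]⟩
    exact isInteriorPoint_of_height_pos c hxr h0
  · simp only [mem_preimage, mem_Icc, not_and_or, not_le] at hw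
    rcases hw with h | h
    · exact Or.inl h.le
    · exact Or.inr h.le
  · have hinj : Injective (Φ : W → W) := Φ.injective
    rw [hset α hαβ, hset β le_rfl, image_sdiff hinj, himage, hlevel]

end Push

end CoreIndependence

/-! ## 4. The registered helper stub -/

/-- **Pushes along an open collar** (registered helper stub of `stub_coreIndependence`): for
open collar data `c` of a boundary datum of a compact manifold with boundary `W` and
`0 < α ≤ β < 1`, a self-diffeomorphism of `W` supported in a compact subset of the interior
carries `c (∂W × [0, α))` onto `c (∂W × [0, β))`.  (A statement PROVED in this file —
`stub_coreIndependencePush` —, not a named fact.) -/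
def CoreIndependencePush : Prop :=
  ∀ (n : ℕ) (W : Type) [TopologicalSpace W] [T2Space W] [CompactSpace W]
    [ChartedSpace (EuclideanHalfSpace (n + 2)) W] [IsManifold (𝓡∂ (n + 2)) ∞ W]
    (b : BoundaryData (𝓡∂ (n + 2)) W (𝓡 (n + 1))) (c : b.OpenCollarData) (α β : ℝ),
    0 < α → α ≤ β → β < 1 →
    ∃ Φ : W ≃ₘ⟮𝓡∂ (n + 2), 𝓡∂ (n + 2)⟯ W,
      (∃ K : Set W, IsCompact K ∧ K ⊆ (𝓡∂ (n + 2)).interior W ∧ ∀ w, w ∉ K → Φ w = w) ∧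
      Φ '' (c.collarMap '' {p | (p.2 : ℝ) < α}) = c.collarMap '' {p | (p.2 : ℝ) < β}

/-- **Registered helper stub `stub_coreIndependencePush`** of line `lp-by-sphere-system-surgery`
(pushes along an open collar, §3). [cite: Milnor1963, Thm. 3.1] -/
theorem stub_coreIndependencePush : CoreIndependencePush :=
  fun _ _ _ _ _ _ _ _ c _ _ hα hαβ hβ => CoreIndependence.exists_diffeomorph_image_collar_eq c hα hαβ hβ

end Summit.SmoothPoincare4.SmoothPoincare4.Cruxes.AgkCor6Sufficiency.LpBySphereSystemSurgery

end
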